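import Summits.KontsevichZagierPeriods.KontsevichZagierPeriods.Theses.UnfoldedStokes
import Summits.KontsevichZagierPeriods.KontsevichZagierPeriods.Theorems.UnfoldedStokesCubeKernelStepStubSlabGluing
import Literature.NumberTheory.Transcendental.KZCubicalCalculus
import Literature.NumberTheory.Transcendental.KZKernelConjectureForms
import Literature.NumberTheory.Transcendental.KZLogCalculusProofs

/-!
# `CubeKernelStep` (stmt-KontsevichZagierPeriods-17854) — SPLIT GLUE of the crux-strategist decomposition

Crux-strategist s1 (planner-cstrat-stmt-KontsevichZagierPeriods-17854-s1-0), 2026-08-17.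
Theorems-shaped, sorry-free; to be landed by a prover as
`Theorems/UnfoldedStokesCubeKernelStepSplit.lean` (`--supports stmt-KontsevichZagierPeriods-17854`)
— Summits/Theorems is prover-only, so this file is attached as item evidence and published under
`Cruxes/CubeKernelStep/Split.lean`.

THE DECOMPOSITION (functional ∥ sporadic dévissage over the parameter coordinate `s = z 0`; the cut
of the live line `Lines/Sketch.lean`, card `Ideas/relative-injectivity-functional-layer.md`, promoted
to route level so that the two halves are staffed by their own chains):

  `CubeKernelStep ⟸ MeanRealisation ∧ FibreNullGerm`      (`cubeKernelStep_of_subs`, PROVED here)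

* `MeanRealisation` (child 1, the SPORADIC core, GPC-strength in weight `d+1`): under the lower layers
  `K(≤d)`, a continuous closed `(d+1)`-cube representation of value `0` is congruent modulo
  `KZ.relations` to a continuous closed `(d+1)`-cube representation all of whose slice values over
  `z 0` vanish — verbatim the registered stub `stub_meanRealisation`.
* `FibreNullGerm` (child 2, the FUNCTIONAL layer, Ayoub-relative strength): under `K(≤d)`, a
  continuous fibre-null family is a relation on every small rational slab around every parameter
  value — verbatim the registered stub `stub_fibreNullGerm`.
* glue: `MeanRealisation → FibreNullGerm → CubeKernelStep` — K2, then K1 at every `s₀ ∈ [0,1]`, a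
  Lebesgue number of the window cover gives a rational equipartition all of whose slabs are
  relations (`exists_equipartition_of_germs`), then the LANDED slab gluing
  (`Layers.stub_slabGluing`, p146658), and `[t] = ([t] − [t']) + [t']`. Not a one-line seam.

CALIBRATION (both children are consequences of the summit, neither is the crux reworded):
`meanRealisation_of_cubeKernelStep` (take `t'` = the zero representation on the cube) and
`fibreNullGerm_of_kzKernelConjecture` (a slab of a fibre-null family has value `0` by Fubini on the
slab, `KZ.IntegralRep.value_slabRestrict`). The converse probes `child → CubeKernelStep`,
`child → KontsevichZagierPeriods` fail (bc/ files of the strategist folder; PROBES in SPLIT-FILING.md).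

References: Kontsevich–Zagier 2001 §1.2; Ayoub, Ann. of Math. 181 (2015) Rem. 1.2, and the
revisited note (Tohoku) Thm 1.7/1.11 (relative version = the model of child 2).
-/

noncomputable section

-- `Summit.KontsevichZagierPeriods.KontsevichZagierPeriods.…` is the tree's mandated layout.
set_option linter.dupNamespace false

namespace Summit.KontsevichZagierPeriods.KontsevichZagierPeriods.CubeKernelStepSplit

open MeasureTheory Set Filter Metric
open scoped Topology
open Literature.NumberTheory.Transcendental
open Literature.NumberTheory.Transcendental.KZ
open Summit.KontsevichZagierPeriods.KontsevichZagierPeriods.Theses.UnfoldedStokes (CubeKernelStep)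

/-! ## The Lebesgue-number step -/

/-- **Lebesgue-number step.** If around every parameter `s₀ ∈ [0,1]` all small rational slabs of a
family are relations, then for some `N ≥ 1` every slab of the rational equipartition of mesh `1/N`
is a relation (compactness of `[0,1]`: `lebesgue_number_lemma_of_metric`; then `1/N < δ`).
(The composition step of the live skeleton `Lines/Sketch.lean`, re-proved here so that the glue is
a standalone theorem.) [folklore] -/
theorem exists_equipartition_of_germs {d : ℕ} (t : IntegralRep (d + 1))
    (hgerm : ∀ s₀ ∈ Set.Icc (0:ℝ) 1, ∃ ε : ℝ, 0 < ε ∧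
      ∀ a b : ℚ, s₀ - ε ≤ (a : ℝ) → (a : ℝ) < b → (b : ℝ) ≤ s₀ + ε →
        of (t.slabRestrict a b) ∈ relations) :
    ∃ N : ℕ, 0 < N ∧
      ∀ k : ℕ, k < N → of (t.slabRestrict ((k : ℚ) / N) (((k : ℚ) + 1) / N)) ∈ relations := by
  classical
  choose! ε hε hslab using hgerm
  obtain ⟨δ, hδ, hcov⟩ := lebesgue_number_lemma_of_metric (ι := Set.Icc (0:ℝ) 1) isCompact_Icc
    (c := fun i => ball (i : ℝ) (ε i)) (fun _ => isOpen_ball)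
    (fun x hx => Set.mem_iUnion.mpr ⟨⟨x, hx⟩, mem_ball_self (hε x hx)⟩)
  obtain ⟨N, hN⟩ := exists_nat_one_div_lt hδ
  refine ⟨N + 1, Nat.succ_pos N, fun k hk => ?_⟩
  have hNpos : (0:ℝ) < (N + 1 : ℕ) := by exact_mod_cast Nat.succ_pos N
  have hk' : (k : ℝ) ≤ N := by exact_mod_cast Nat.lt_succ_iff.mp hk
  set x : ℝ := (k : ℝ) / (N + 1 : ℕ) with hx
  have hx0 : 0 ≤ x := div_nonneg (Nat.cast_nonneg k) hNpos.le
  have hx1 : x ≤ 1 := by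
    rw [hx, div_le_one hNpos]
    push_cast
    linarith
  obtain ⟨⟨s₀, hs₀⟩, hball⟩ := hcov x ⟨hx0, hx1⟩
  have hmesh : (1:ℝ) / (N + 1 : ℕ) < δ := by simpa using hN
  have hxs : x ∈ ball s₀ (ε s₀) := hball (mem_ball_self hδ)
  have hys : x + 1 / (N + 1 : ℕ) ∈ ball s₀ (ε s₀) := by
    refine hball ?_
    rw [mem_ball, Real.dist_eq, add_sub_cancel_left, abs_of_pos (by positivity)]
    exact hmesh
  rw [mem_ball, Real.dist_eq, abs_lt] at hxs hys
  refine hslab s₀ hs₀ _ _ ?_ ?_ ?_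
  · have : (((k : ℚ) / (N + 1 : ℕ) : ℚ) : ℝ) = x := by rw [hx]; push_cast; ring
    rw [this]; linarith [hxs.1]
  · push_cast
    exact div_lt_div_of_pos_right (by linarith) (by exact_mod_cast Nat.succ_pos N)
  · have : ((((k : ℚ) + 1) / (N + 1 : ℕ) : ℚ) : ℝ) = x + 1 / (N + 1 : ℕ) := by
      rw [hx]; push_cast; ring
    rw [this]; linarith [hys.2]

/-! ## The glue: `MeanRealisation → FibreNullGerm → CubeKernelStep` -/

/-- **`CubeKernelStep` from its two sub-cruxes** (children of the route split, stated verbatim):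
mean realisation (K2: every value-`0` continuous closed-cube family is congruent modulo relations to
a FIBRE-NULL one) and fibre-null germs (K1: under the lower layers, a continuous fibre-null family is
a relation on every small rational slab around every parameter value). Proof: K2; K1 at every
`s₀ ∈ [0,1]`; a Lebesgue number gives a rational equipartition all of whose slabs are relations
(`exists_equipartition_of_germs`); slab gluing (`Layers.stub_slabGluing`, landed p146658);
`[t] = ([t] − [t']) + [t']`. [folklore] -/
theorem cubeKernelStep_of_subs
    (h2 : ∀ d : ℕ, 1 ≤ d →
      (∀ (M : ℕ), M ≤ d → ∀ (a : IntegralRep M),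
        a.domain = Set.pi Set.univ (fun _ : Fin M => Set.Icc (0:ℝ) 1) →
        ContinuousOn a.integrand a.domain → a.value = 0 → of a ∈ relations) →
      ∀ (t : IntegralRep (d + 1)),
        t.domain = Set.pi Set.univ (fun _ : Fin (d + 1) => Set.Icc (0:ℝ) 1) →
        ContinuousOn t.integrand t.domain → t.value = 0 →
        ∃ t' : IntegralRep (d + 1),
          t'.domain = Set.pi Set.univ (fun _ : Fin (d + 1) => Set.Icc (0:ℝ) 1) ∧
          ContinuousOn t'.integrand t'.domain ∧
          (∀ s ∈ Set.Icc (0:ℝ) 1, sliceValue t' s = 0) ∧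
          of t - of t' ∈ relations)
    (h1 : ∀ d : ℕ, 1 ≤ d →
      (∀ (M : ℕ), M ≤ d → ∀ (a : IntegralRep M),
        a.domain = Set.pi Set.univ (fun _ : Fin M => Set.Icc (0:ℝ) 1) →
        ContinuousOn a.integrand a.domain → a.value = 0 → of a ∈ relations) →
      ∀ (t : IntegralRep (d + 1)),
        t.domain = Set.pi Set.univ (fun _ : Fin (d + 1) => Set.Icc (0:ℝ) 1) →
        ContinuousOn t.integrand t.domain →
        (∀ s ∈ Set.Icc (0:ℝ) 1, sliceValue t s = 0) →
        ∀ s₀ ∈ Set.Icc (0:ℝ) 1, ∃ ε : ℝ, 0 < ε ∧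
          ∀ a b : ℚ, s₀ - ε ≤ (a : ℝ) → (a : ℝ) < b → (b : ℝ) ≤ s₀ + ε →
            of (t.slabRestrict a b) ∈ relations) :
    CubeKernelStep := by
  intro d hd hLE t htd htc hval
  -- K2: trade `t` for a fibre-null continuous family `t'`
  obtain ⟨t', ht'd, ht'c, ht'n, htt'⟩ := h2 d hd hLE t htd htc hval
  -- K1 at every parameter, a Lebesgue number, slab gluing
  obtain ⟨N, hN, hk⟩ := exists_equipartition_of_germs t' (h1 d hd hLE t' ht'd ht'c ht'n)
  have ht' : of t' ∈ relations :=
    Summit.KontsevichZagierPeriods.KontsevichZagierPeriods.Cruxes.CubeKernelStep.Layers.stub_slabGluing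
      d t' ht'd N hN hk
  have e : of t = (of t - of t') + of t' := by abel
  rw [e]
  exact relations.add_mem htt' ht'

/-! ## Calibration: both children are consequences of the crux / of the kernel conjecture -/

/-- In dimension `d + 1`, the slice over a parameter value outside `[0,1]` of a family on the closed
unit cube is empty, so its slice value is `0`. [folklore] -/
theorem sliceValue_eq_zero_of_not_mem {d : ℕ} (t : IntegralRep (d + 1))
    (htd : t.domain = Set.pi Set.univ (fun _ : Fin (d + 1) => Set.Icc (0:ℝ) 1))
    {s : ℝ} (hs : s ∉ Set.Icc (0:ℝ) 1) : sliceValue t s = 0 := by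
  rw [sliceValue_def]
  have hset : {x : Fin d → ℝ | Matrix.vecCons s x ∈ t.domain} = ∅ := by
    refine Set.eq_empty_of_forall_notMem fun x hx => hs ?_
    have hx' : Matrix.vecCons s x ∈ Set.pi Set.univ (fun _ : Fin (d + 1) => Set.Icc (0:ℝ) 1) := by
      rw [← htd]; exact hx
    simpa using hx' 0 (Set.mem_univ _)
  rw [hset, Measure.restrict_empty, integral_zero_measure]

/-- **Child 1 is implied by the crux**: given `CubeKernelStep`, take `t'` = the zero representation
on the closed cube (`KZ.exists_zeroRep`): it is continuous, fibre-null, and `[t] − [t'] ∈ relations`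
because both summands are. [folklore] -/
theorem meanRealisation_of_cubeKernelStep (h : CubeKernelStep) :
    ∀ d : ℕ, 1 ≤ d →
      (∀ (M : ℕ), M ≤ d → ∀ (a : IntegralRep M),
        a.domain = Set.pi Set.univ (fun _ : Fin M => Set.Icc (0:ℝ) 1) →
        ContinuousOn a.integrand a.domain → a.value = 0 → of a ∈ relations) →
      ∀ (t : IntegralRep (d + 1)),
        t.domain = Set.pi Set.univ (fun _ : Fin (d + 1) => Set.Icc (0:ℝ) 1) →
        ContinuousOn t.integrand t.domain → t.value = 0 →
        ∃ t' : IntegralRep (d + 1),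
          t'.domain = Set.pi Set.univ (fun _ : Fin (d + 1) => Set.Icc (0:ℝ) 1) ∧
          ContinuousOn t'.integrand t'.domain ∧
          (∀ s ∈ Set.Icc (0:ℝ) 1, sliceValue t' s = 0) ∧
          of t - of t' ∈ relations := by
  intro d hd hLE t htd htc hval
  obtain ⟨z, hzd, hzi⟩ := exists_zeroRep (n := d + 1) isSemialgebraic_cube
  refine ⟨z, by rw [hzd, cube_eq_pi], ?_, fun s _ => ?_, ?_⟩
  · rw [hzi]; exact continuousOn_const
  · rw [sliceValue_def]
    simp [hzi]
  · exact relations.sub_mem (h d hd hLE t htd htc hval)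
      (of_mem_relations_of_eqOn_zero z (by simp [hzi, EqOn]))

/-- **Child 2 is implied by the kernel conjecture** (hence by the summit,
`kzKernelConjecture_iff_isRational`): a rational slab of a fibre-null family on the closed cube has
value `0` (Fubini on the slab, `KZ.IntegralRep.value_slabRestrict`; the slices vanish on `[0,1]` by
hypothesis and off `[0,1]` because they are empty), so it is a relation. The window `ε = 1` works
uniformly. [folklore] -/
theorem fibreNullGerm_of_kzKernelConjecture (h : KZKernelConjecture) :
    ∀ d : ℕ, 1 ≤ d →
      (∀ (M : ℕ), M ≤ d → ∀ (a : IntegralRep M),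
        a.domain = Set.pi Set.univ (fun _ : Fin M => Set.Icc (0:ℝ) 1) →
        ContinuousOn a.integrand a.domain → a.value = 0 → of a ∈ relations) →
      ∀ (t : IntegralRep (d + 1)),
        t.domain = Set.pi Set.univ (fun _ : Fin (d + 1) => Set.Icc (0:ℝ) 1) →
        ContinuousOn t.integrand t.domain →
        (∀ s ∈ Set.Icc (0:ℝ) 1, sliceValue t s = 0) →
        ∀ s₀ ∈ Set.Icc (0:ℝ) 1, ∃ ε : ℝ, 0 < ε ∧
          ∀ a b : ℚ, s₀ - ε ≤ (a : ℝ) → (a : ℝ) < b → (b : ℝ) ≤ s₀ + ε →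
            of (t.slabRestrict a b) ∈ relations := by
  intro d _hd _hLE t htd _htc hnull s₀ _hs₀
  refine ⟨1, one_pos, fun a b _ _ _ => h _ ?_⟩
  have hslice : ∀ s, sliceValue t s = 0 := fun s => by
    by_cases hs : s ∈ Set.Icc (0:ℝ) 1
    · exact hnull s hs
    · exact sliceValue_eq_zero_of_not_mem t htd hs
  rw [eval_of, IntegralRep.value_slabRestrict]
  simp [hslice]

/-- The same from the summit. [folklore] -/
theorem fibreNullGerm_of_summit (h : _root_.KontsevichZagierPeriods) :
    ∀ d : ℕ, 1 ≤ d →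
      (∀ (M : ℕ), M ≤ d → ∀ (a : IntegralRep M),
        a.domain = Set.pi Set.univ (fun _ : Fin M => Set.Icc (0:ℝ) 1) →
        ContinuousOn a.integrand a.domain → a.value = 0 → of a ∈ relations) →
      ∀ (t : IntegralRep (d + 1)),
        t.domain = Set.pi Set.univ (fun _ : Fin (d + 1) => Set.Icc (0:ℝ) 1) →
        ContinuousOn t.integrand t.domain →
        (∀ s ∈ Set.Icc (0:ℝ) 1, sliceValue t s = 0) →
        ∀ s₀ ∈ Set.Icc (0:ℝ) 1, ∃ ε : ℝ, 0 < ε ∧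
          ∀ a b : ℚ, s₀ - ε ≤ (a : ℝ) → (a : ℝ) < b → (b : ℝ) ≤ s₀ + ε →
            of (t.slabRestrict a b) ∈ relations :=
  fibreNullGerm_of_kzKernelConjecture (kzKernelConjecture_iff_isRational.mpr h)

end Summit.KontsevichZagierPeriods.KontsevichZagierPeriods.CubeKernelStepSplit

end
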